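import Mathlib
import Literature.NumberTheory.Transcendental.TranscendentalSpecialization
import Summits.Schanuel.Schanuel.Theorems.RigidCoreSchanuelOnLogFreeCoreExceptionalLineDichotomy
import Summits.Schanuel.Schanuel.Theorems.RigidCoreSchanuelOnLogFreeCoreEndomorphismCriterion

/-!
# Line `sector-split` of crux `RigidCore.SchanuelOnLogFreeCore`: conjugation kills the off-axes
# exceptional lines of ANY anchor on an axis

Crux `stmt-Schanuel-0970` (`Summit.Schanuel.Schanuel.Theses.RigidCore.SchanuelOnLogFreeCore`,
Schanuel's conjecture on the log-free core), line `sector-split` (skeleton v11, lead c5),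
registered calibration stub `stub_conjugationOffAxes`, which is VERBATIM item `stmt-Schanuel-9551`
(`Summit.Schanuel.Schanuel.Theses.ExceptionalSubspaces.ConjugationOffAxes`): for a transcendental
anchor `η ∈ ℝ ∪ iℝ` and an algebraic `α` with `Re α ≠ 0` and `Im α ≠ 0`, the numbers `η` and `e^α`
are algebraically independent over `ℚ`.  Instances: `π ⊥ e^{1+i}`, `log 2 ⊥ e^{1+i}`,
`πi ⊥ e^{√2(1+i)}`.  This is the `d = 1` shadow, for an arbitrary axis anchor, of the axes
reduction `stub_piFree_of_piFreeOnAxes` (p140402) of the line: the exceptional exponents of an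
axis anchor lie on the axes.

Proof (complex conjugation + the exceptional-line dichotomy, all ingredients landed in the tree):
suppose `(η, e^α)` is algebraically dependent.  Since `η` is transcendental, `e^α` is algebraic
over `ℚ(η)` (`isAlgebraic_adjoin_of_not_algebraicIndependent`,
`Literature.NumberTheory.Transcendental.TranscendentalSpecialization`).  Complex conjugation maps
`ℚ(η)` into itself (`conj η = ±η` on the axes), so `conj (e^α) = e^{ᾱ}` is algebraic over `ℚ(η)`
as well (`ConjOffAxes.isAlgebraic_adjoin_anchor_conj`, the transport of
`EndoCriterion.isAlgebraic_adjoin_pi_map` of `…EndomorphismCriterion` (p140410) from `π` to `η`).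
But `(α, ᾱ)` is `ℚ`-linearly independent (`EndoCriterion.linearIndependent_pair_of_map_ne` at
`j = conj`: `ᾱ ≠ α` as `Im α ≠ 0`, `ᾱ ≠ −α` as `Re α ≠ 0`), so by the exceptional-line dichotomy
(`KernelTower.not_isAlgebraic_adjoin_anchor_exp_pair` of `…ExceptionalLineDichotomy`, p140109:
Lindemann–Weierstrass `e^α ⊥ e^{ᾱ}` against `trdeg ℚ(η)^alg = 1`) they cannot both have
exponentials algebraic over `ℚ(η)` — contradiction.  No `Theses` module is imported here; the
literal match `example : ExceptionalSubspaces.ConjugationOffAxes := stub_conjugationOffAxes` is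
checked in the line's skeleton (`Cruxes/SchanuelOnLogFreeCore/Lines/sector_split.lean`, v11).

## References

* [BakerTNT1975] A. Baker, *Transcendental Number Theory*, Cambridge University Press (1975),
  Ch. 1 §3, Theorem 1.4 (Lindemann–Weierstrass), p. 6.
* [Diaz2004] G. Diaz, *Utilisation de la conjugaison complexe dans l'étude de la transcendance de
  valeurs de la fonction exponentielle usuelle*, J. Théor. Nombres Bordeaux 16 (2004) 535–553,
  doi:10.5802/jtnb.459 — the conjugation device with transcendence-only outputs (Thm 5, Prop. 1).
-/

noncomputable section

-- `Summit.Schanuel.Schanuel.…` is the D-0017 single-problem layout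
set_option linter.dupNamespace false

namespace Summit.Schanuel.Schanuel.Theorems.RigidCore

open Literature.NumberTheory.Transcendental
open Literature.NumberTheory.Transcendental.Specialization
open IntermediateField

namespace ConjOffAxes

/-- On the axes complex conjugation acts by a sign: `conj η = η` (`η` real) or `conj η = −η`
(`η` purely imaginary). [folklore] -/
theorem conj_eq_or {η : ℂ} (hη : η.im = 0 ∨ η.re = 0) :
    (starRingEnd ℂ) η = η ∨ (starRingEnd ℂ) η = -η := by
  rcases hη with h | h
  · exact Or.inl (Complex.conj_eq_iff_im.2 h)
  · right
    apply Complex.ext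
    · simp [h]
    · simp

/-- Complex conjugation maps the field `ℚ(η)` into itself when `η` lies on an axis. [folklore] -/
theorem conj_mem_adjoin_anchor {η : ℂ} (hη : η.im = 0 ∨ η.re = 0) {x : ℂ}
    (hx : x ∈ adjoin ℚ ({η} : Set ℂ)) : (starRingEnd ℂ) x ∈ adjoin ℚ ({η} : Set ℂ) := by
  induction hx using IntermediateField.adjoin_induction with
  | mem x hx =>
    rw [Set.mem_singleton_iff] at hx
    subst hx
    rcases conj_eq_or hη with h | h
    · rw [h]; exact mem_adjoin_simple_self ℚ _
    · rw [h]; exact neg_mem (mem_adjoin_simple_self ℚ _)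
  | algebraMap q =>
    rw [show (starRingEnd ℂ) (algebraMap ℚ ℂ q) = algebraMap ℚ ℂ q from
      (starRingEnd ℂ).toRatAlgHom.commutes q]
    exact IntermediateField.algebraMap_mem _ q
  | add x y _ _ hx hy => rw [map_add]; exact add_mem hx hy
  | inv x _ hx => rw [map_inv₀]; exact inv_mem hx
  | mul x y _ _ hx hy => rw [map_mul]; exact mul_mem hx hy

/-- Transport along conjugation: if `y` is algebraic over `ℚ(η)` (`η` on an axis) then so is
`conj y`. [folklore] -/
theorem isAlgebraic_adjoin_anchor_conj {η : ℂ} (hη : η.im = 0 ∨ η.re = 0) {y : ℂ}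
    (hy : IsAlgebraic (adjoin ℚ ({η} : Set ℂ)) y) :
    IsAlgebraic (adjoin ℚ ({η} : Set ℂ)) ((starRingEnd ℂ) y) := by
  set K := adjoin ℚ ({η} : Set ℂ) with hK
  let σ : K →+* K :=
    { toFun := fun x => ⟨(starRingEnd ℂ) x, conj_mem_adjoin_anchor hη x.2⟩
      map_one' := Subtype.ext (map_one _)
      map_mul' := fun a b => Subtype.ext (map_mul _ _ _)
      map_zero' := Subtype.ext (map_zero _)
      map_add' := fun a b => Subtype.ext (map_add _ _ _) }
  have hσ : Function.Injective σ := fun a b h =>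
    Subtype.ext ((starRingEnd ℂ).injective (congrArg Subtype.val h))
  exact hy.ringHom_of_comp_eq σ (starRingEnd ℂ) hσ (RingHom.ext fun _ => rfl)

/-- Off the axes `α` and `ᾱ` are `ℚ`-linearly independent (`ᾱ ∉ {α, −α}`; the orbit lemma
`EndoCriterion.linearIndependent_pair_of_map_ne` at `j = conj`). [folklore] -/
theorem linearIndependent_self_conj {α : ℂ} (hα : IsAlgebraic ℚ α) (hre : α.re ≠ 0)
    (him : α.im ≠ 0) : LinearIndependent ℚ ![α, (starRingEnd ℂ) α] := by
  refine EndoCriterion.linearIndependent_pair_of_map_ne (starRingEnd ℂ) hα ?_ ?_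
  · exact fun h => him (Complex.conj_eq_iff_im.1 h)
  · intro h
    have h' := congrArg Complex.re h
    rw [Complex.conj_re, Complex.neg_re] at h'
    exact hre (by linarith)

end ConjOffAxes

open ConjOffAxes

/-- **Stub `stub_conjugationOffAxes` of line `sector-split`** (registered signature, v11; item
stmt-Schanuel-9551 `ExceptionalSubspaces.ConjugationOffAxes` verbatim): for a transcendental
anchor `η ∈ ℝ ∪ iℝ` and an algebraic `α` with `Re α ≠ 0`, `Im α ≠ 0`, the pair `(η, e^α)` is
algebraically independent over `ℚ`.  [cite: BakerTNT1975, Ch. 1 Thm 1.4] -/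
theorem stub_conjugationOffAxes :
    ∀ η α : ℂ, (η.im = 0 ∨ η.re = 0) → Transcendental ℚ η → IsAlgebraic ℚ α → α.re ≠ 0 →
      α.im ≠ 0 → AlgebraicIndependent ℚ ![η, Complex.exp α] := by
  intro η α hax hη hα hre him
  by_contra hdep
  -- `e^α` is algebraic over `ℚ(η)`
  have h1' := isAlgebraic_adjoin_of_not_algebraicIndependent hη hdep
  have h1 : IsAlgebraic (adjoin ℚ ({η} : Set ℂ)) (Complex.exp α) := by
    by_contra h
    exact (IntermediateField.transcendental_adjoin_iff.mp h) h1'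
  -- hence so is `e^{ᾱ} = conj (e^α)`
  have h2 : IsAlgebraic (adjoin ℚ ({η} : Set ℂ)) (Complex.exp ((starRingEnd ℂ) α)) := by
    rw [Complex.exp_conj]
    exact isAlgebraic_adjoin_anchor_conj hax h1
  -- but `(α, ᾱ)` is `ℚ`-free: the exceptional-line dichotomy forbids both
  have hαc : IsAlgebraic ℚ ((starRingEnd ℂ) α) :=
    IsAlgebraic.algHom (starRingEnd ℂ).toRatAlgHom hα
  exact KernelTower.not_isAlgebraic_adjoin_anchor_exp_pair η α ((starRingEnd ℂ) α) hη hα hαc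
    (linearIndependent_self_conj hα hre him) ⟨h1, h2⟩

/-- Curried form: `η ⊥ e^α` for an axis anchor `η` and an off-axes algebraic exponent `α`.
[cite: BakerTNT1975, Ch. 1 Thm 1.4] -/
theorem KernelTower.algebraicIndependent_anchor_exp_offAxes {η α : ℂ} (hax : η.im = 0 ∨ η.re = 0)
    (hη : Transcendental ℚ η) (hα : IsAlgebraic ℚ α) (hre : α.re ≠ 0) (him : α.im ≠ 0) :
    AlgebraicIndependent ℚ ![η, Complex.exp α] :=
  stub_conjugationOffAxes η α hax hη hα hre him

/-- **The exceptional exponents of an axis anchor lie on the axes** (`d = 1` shadow of the axes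
reduction): if `η ∈ ℝ ∪ iℝ` is transcendental, `α` is algebraic and `(η, e^α)` is algebraically
DEPENDENT, then `α` is real or purely imaginary. [cite: BakerTNT1975, Ch. 1 Thm 1.4] -/
theorem KernelTower.onAxes_of_not_algebraicIndependent_anchor_exp {η α : ℂ}
    (hax : η.im = 0 ∨ η.re = 0) (hη : Transcendental ℚ η) (hα : IsAlgebraic ℚ α)
    (hdep : ¬ AlgebraicIndependent ℚ ![η, Complex.exp α]) : α.im = 0 ∨ α.re = 0 := by
  by_contra h
  obtain ⟨him, hre⟩ := not_or.mp h
  exact hdep (stub_conjugationOffAxes η α hax hη hα hre him)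

end Summit.Schanuel.Schanuel.Theorems.RigidCore

end
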